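import Summits.HodgeConjecture.HodgeConjecture.Theses.HeckePrymWeil
import Summits.HodgeConjecture.HodgeConjecture.Theorems.HeckePrymWeilHeckePrymAnchorsUpgrade
import Summits.HodgeConjecture.HodgeConjecture.Theorems.HeckePrymWeilHyperbolicEightfoldsSqrtMinus7OfAnchorObject
import Literature.AlgebraicGeometry.HodgeTheory.AbelianVarietyEndomorphismsHOne
import Literature.AlgebraicGeometry.HodgeTheory.AbelianVarietyPullbackAlgebraicClasses
import Literature.AlgebraicGeometry.HodgeTheory.AlgebraicClassesCupAbelianVariety
import Literature.AlgebraicGeometry.HodgeTheory.HardLefschetzNFoldHolds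
import Literature.AlgebraicGeometry.HodgeTheory.HodgeRiemannDegreeOneProofs
import Literature.AlgebraicGeometry.HodgeTheory.WeilClasses
import Literature.AlgebraicGeometry.Motives.AbelianVarietyCohomologyExteriorH1
import Literature.AlgebraicGeometry.Motives.AbelianVarietyProduct
import Literature.AlgebraicGeometry.Motives.AbelianVarietyProductDimProofs
import Literature.AlgebraicGeometry.Motives.AbelianVarietyExistence
import Literature.AlgebraicGeometry.Motives.HyperbolicWeilTypeProduct
import HarnessLib

/-!
# The Weil plane of a TENSOR SQUARE `(X × X, ψ₀ = (0, -d; 1, 0))` is algebraic — and the crux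
# `HeckePrymWeil.WeilTenfoldsSqrtMinus11` (stmt-HodgeConjecture-1262) on every tensor tenfold `X₅ × X₅`

Route `HeckePrymWeil`, crux `WeilTenfoldsSqrtMinus11`, line `generic-ppav-secant-descent` (lead c4, 2026-08-17);
registered sub-goals `stub_tensorSquareWeilClassesAlgebraic`, `stub_tensorSquareCrux` of the item.

**Theorem.** For every complex abelian `n`-fold `X`, `n ≥ 1`, every `d ≥ 1`, `A = X × X` with the off-diagonal
`ψ₀ = ⟨pr₂ ≫ (-d), pr₁⟩` (`ψ₀ ≫ ψ₀ = -d`), the Weil plane `weilClassesOf A ψ₀ n d = E₊ ⊔ E₋ ⊆ H²ⁿ(A(ℂ); ℂ)` is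
ALGEBRAIC. Proof (no Chern character): `v_k(μ) = pr₁^*e_k + μ·pr₂^*e_k` is a `μ`-eigenvector of `ψ₀^*` on `H¹(A)`
for `μ² = -d`; the top cup product `w(μ) = ⌣_k v_k(μ)` over a basis `(e_k)` of `H¹(X)` is a joint eigenclass of the
`(x·𝟙 + y·ψ₀)^*` with character `(x + yμ)²ⁿ`, i.e. `w(±i√d) ∈ E±`, non-zero (the `v_k` are independent — pull back
along `(𝟙, 0)` — and `H•(A) = ⋀•H¹`, a theorem of the tree); `t ↦ w(t)` is POLYNOMIAL of degree `≤ 2n`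
(multilinearity), so `w(μ) ∈ span_ℂ {w(0), …, w(2n)}` (interpolation), and `w(t) = (pr₁ + t·pr₂)^*(⌣_k e_k)` for
`t ∈ ℕ` is the pull-back along a HOMOMORPHISM `A ⟶ X` of a top class of `X`; `H²ⁿ(X)` is the line through the
algebraic `θⁿ ≠ 0` (hyperplane class: Kleiman powers + hard Lefschetz, theorems of the tree), and pull-back to a
smooth projective variety along a morphism to an abelian variety preserves algebraic classes
(`map_mem_algebraicClasses_of_abelianVariety`); each `E±` is a line (`finrank_weilClassesPlus/Minus_eq_one`).

**Corollary** (`n = 5`, `d = 11`, typing upgrade `stub_upgrade`): the crux HOLDS on every tensor tenfold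
`(X₅ × X₅, ψ₀)` — the second anchor family settled in the tree after the norm anchors (p112065); at `n = 6`: the
intended anchor `X₆ × X₆` of the bet `stub_secantSpreadEmbedded` has an algebraic Weil plane (Step 0 of Markman's
programme, arXiv:2502.03415 §1; the open part is the DEFORMATION, i.e. the semiregular secant object).
-/

noncomputable section

-- single-problem summit (Problem = Summit): the mandated namespace repeats `HodgeConjecture`.
set_option linter.dupNamespace false

open CategoryTheory Polynomial
open Literature.AlgebraicGeometry Literature.AlgebraicGeometry.Motives
  Literature.AlgebraicGeometry.HodgeTheory
open Literature.AlgebraicTopology.SingularHomology Literature.Geometry.Kaehler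
open Summit.HodgeConjecture.HodgeConjecture.Theorems.HyperbolicEightfoldsSqrtMinus7.AnchorObject
  (cupPowTwo_mem_algebraicClasses_abelian)

namespace Summit.HodgeConjecture.HodgeConjecture.Theorems.WeilTenfoldsSqrtMinus11.TensorSquare

/-! ## §1 Interpolation: a multilinear map along a line -/
section Interpolation

variable {M N : Type*} [AddCommGroup M] [Module ℂ M] [AddCommGroup N] [Module ℂ N] {m : ℕ}

/-- Expansion of a multilinear map along a line: `f (a + t • b) = ∑ₛ t ^ #sᶜ • f (s.piecewise a b)` (multi-additivity
over all coordinates, then the scalars `t` pulled out of the coordinates outside `s`). [folklore] -/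
theorem apply_add_smul_eq_sum (f : MultilinearMap ℂ (fun _ : Fin m => M) N) (a b : Fin m → M) (t : ℂ) :
    f (a + t • b) = ∑ s : Finset (Fin m), t ^ (sᶜ.card) • f (s.piecewise a b) := by
  classical
  rw [MultilinearMap.map_add_univ]
  refine Finset.sum_congr rfl fun s _ => ?_
  have hpw : s.piecewise a (t • b) = fun i => (if i ∈ s then (1 : ℂ) else t) • s.piecewise a b i := by
    funext i
    by_cases hi : i ∈ s
    · simp [hi]
    · simp [hi]
  rw [hpw, MultilinearMap.map_smul_univ]
  congr 1
  rw [Finset.prod_ite, Finset.prod_const_one, one_mul, Finset.prod_const]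
  congr 1
  rw [Finset.card_compl, Finset.filter_not, Finset.card_sdiff_of_subset (Finset.filter_subset _ _),
    Finset.card_univ]
  congr 1
  rw [Finset.filter_mem_eq_inter, Finset.univ_inter]

/-- **Interpolation**: `f (a + μ • b)` lies in the `ℂ`-span of the `m + 1` values `f (a + t • b)`, `t = 0, …, m`:
tested against a linear functional on the quotient by that span, `t ↦ f (a + t • b)` is a polynomial of degree
`≤ m` with `m + 1` roots. [folklore] -/
theorem apply_add_smul_mem_span (f : MultilinearMap ℂ (fun _ : Fin m => M) N) (a b : Fin m → M) (μ : ℂ) :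
    f (a + μ • b) ∈ Submodule.span ℂ (Set.range fun t : Fin (m + 1) => f (a + ((t : ℕ) : ℂ) • b)) := by
  classical
  set S := Submodule.span ℂ (Set.range fun t : Fin (m + 1) => f (a + ((t : ℕ) : ℂ) • b)) with hS
  rw [← Submodule.ker_mkQ S, LinearMap.mem_ker, ← Module.forall_dual_apply_eq_zero_iff ℂ]
  intro φ
  set ψ : N →ₗ[ℂ] ℂ := φ ∘ₗ S.mkQ with hψ
  set P : ℂ[X] := ∑ s : Finset (Fin m), C (ψ (f (s.piecewise a b))) * X ^ (sᶜ.card) with hP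
  have hPeval : ∀ t : ℂ, P.eval t = ψ (f (a + t • b)) := by
    intro t
    rw [apply_add_smul_eq_sum, hP, eval_finsetSum, map_sum]
    refine Finset.sum_congr rfl fun s _ => ?_
    rw [eval_mul, eval_C, eval_pow, eval_X, map_smul, smul_eq_mul, mul_comm]
  have hroots : ∀ i : Fin (m + 1), P.eval ((i : ℕ) : ℂ) = 0 := by
    intro i
    rw [hPeval, hψ, LinearMap.comp_apply]
    have hmem : f (a + ((i : ℕ) : ℂ) • b) ∈ S := Submodule.subset_span ⟨i, rfl⟩
    have h0 : S.mkQ (f (a + ((i : ℕ) : ℂ) • b)) = 0 := by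
      rwa [← LinearMap.mem_ker, Submodule.ker_mkQ]
    rw [h0, map_zero]
  have hdeg : P.natDegree < Fintype.card (Fin (m + 1)) := by
    rw [Fintype.card_fin, hP]
    refine Nat.lt_succ_of_le ?_
    refine natDegree_sum_le_of_forall_le _ _ fun s _ => ?_
    refine (natDegree_C_mul_X_pow_le _ _).trans ?_
    exact (Finset.card_le_univ _).trans (by rw [Fintype.card_fin])
  have hinj : Function.Injective fun i : Fin (m + 1) => ((i : ℕ) : ℂ) :=
    fun i j h => Fin.ext (Nat.cast_injective (R := ℂ) h)
  have hP0 : P = 0 := eq_zero_of_natDegree_lt_card_of_eval_eq_zero P hinj hroots hdeg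
  have h := hPeval μ
  rw [hP0, eval_zero] at h
  rw [← LinearMap.comp_apply, ← hψ]; exact h.symm

end Interpolation

/-! ## §2 Cohomological lemmas -/
/-- If the unit class vanishes, every iterated cup product of degree-one classes vanishes. [folklore] -/
theorem cupPowOne_eq_zero_of_one_eq_zero {Y : Type} [TopologicalSpace Y] (h1 : singularCohomology.one ℂ Y = 0) :
    ∀ (k : ℕ) (v : Fin k → singularCohomology ℂ ℂ Y 1), cupPowOne ℂ Y k v = 0
  | 0, v => by rw [cupPowOne_zero, h1]
  | k + 1, v => by rw [cupPowOne_succ, cupPowOne_eq_zero_of_one_eq_zero h1 k, map_zero]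

/-- **A non-zero ALGEBRAIC top-degree class on an abelian `n`-fold**, `n ≥ 1`: the power `θⁿ` of the hyperplane
class of the tree's hard-Lefschetz datum (`nonempty_hardLefschetzNFold_holds`) is algebraic (Kleiman powers, the landed `cupPowTwo_mem_algebraicClasses_abelian`) and
non-zero (hard Lefschetz: `Lⁿ : H⁰ → H²ⁿ` is injective and `1 ≠ 0` as soon as some cup product is non-zero).
[cite: VoisinHodgeI2002, Thm. 6.25] [cite: VoisinHodgeII2003, §9.2.4 Prop. 9.20] -/
theorem exists_ne_zero_mem_algebraicClasses_top (X : AbelianVariety ℂ) {n : ℕ} (hX : X.dim = n) (hn : 0 < n)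
    {k : ℕ} (v : Fin k → complexBetti X.X 1) (hv : cupPowOne ℂ (ComplexPoints X.X) k v ≠ 0) :
    ∃ Z : complexBetti X.X (2 * n), Z ≠ 0 ∧ Z ∈ algebraicClasses X.X n := by
  have hXsp : IsSmoothProjective n X.X := isSmoothProjective_of_dim_eq' hX
  obtain ⟨Λ⟩ := nonempty_hardLefschetzNFold_holds n X.X hXsp
  obtain ⟨n', rfl⟩ : ∃ n', n = n' + 1 := ⟨n - 1, by omega⟩
  refine ⟨cupPowTwo Λ.hyperplaneClass (n' + 1), fun hZ => ?_,
    cupPowTwo_mem_algebraicClasses_abelian X Λ.hyperplaneClass_mem n'⟩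
  -- `1 ≠ 0` in `H⁰(X(ℂ))`
  have h1 : singularCohomology.one ℂ (ComplexPoints X.X) ≠ 0 := fun h1 =>
    hv (cupPowOne_eq_zero_of_one_eq_zero h1 k v)
  -- hard Lefschetz: `Lⁿ 1 = 1 ⌣ θⁿ = 0` forces `1 = 0`
  have hbij := Λ.hasHardLefschetz (n' + 1) 0 (zero_add _)
  have hL : lefschetzPow Λ.hyperplaneClass (n' + 1) 0 (singularCohomology.one ℂ (ComplexPoints X.X)) = 0 := by
    rw [HodgeRiemannDegreeOne.lefschetzPow_eq_cupProduct_cupPowTwo, hZ, map_zero]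
  exact h1 (hbij.1 (hL.trans (map_zero _).symm))

section Square

variable (X : AbelianVariety ℂ) (d : ℕ) {ψ : X.prod X ⟶ X.prod X}

/- The off-diagonal endomorphism `ψ₀ = ⟨pr₂ ≫ (-d·𝟙), pr₁⟩ : (x, y) ↦ (-d·y, x)` of `X × X` is only ever used through
its two components `hψ₁ : ψ ≫ pr₁ = pr₂ ≫ (-d·𝟙)`, `hψ₂ : ψ ≫ pr₂ = pr₁` (`prodLift_fst/snd`), so the lemmas below are
stated for any `ψ` with these components (no definition is introduced). -/

/-- `[z]^* = z` on `H¹`: `(z • 𝟙)^* e = z • e`. [cite: MumfordAV1970, §19] -/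
theorem complexBetti_map_zsmul_id_one_apply (z : ℤ) (e : complexBetti X.X 1) :
    complexBetti.map (z • 𝟙 X).hom.hom.hom 1 e = (z : ℂ) • e := by
  have h := complexBetti_map_zsmul_id_add_zsmul_one (𝟙 X) z 0 e
  simp only [zero_smul, add_zero, Int.cast_zero] at h
  exact h

/-- `ψ₀^*(pr₁^* e) = -d · pr₂^* e` on `H¹`. [cite: MumfordAV1970, §19] -/
theorem map_offDiag_map_fst_one
    (hψ₁ : ψ ≫ AbelianVariety.fst X X = AbelianVariety.snd X X ≫ ((-(d : ℤ)) • 𝟙 X)) (e : complexBetti X.X 1) :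
    complexBetti.map ψ.hom.hom.hom 1 (complexBetti.map (AbelianVariety.fst X X).hom.hom.hom 1 e) =
      (-(d : ℂ)) • complexBetti.map (AbelianVariety.snd X X).hom.hom.hom 1 e := by
  change singularCohomology.map ℂ ℂ _ 1 (singularCohomology.map ℂ ℂ _ 1 e) = _
  rw [abelianVarietyHom_map_map_apply, hψ₁, ← abelianVarietyHom_map_map_apply]
  change complexBetti.map (AbelianVariety.snd X X).hom.hom.hom 1
    (complexBetti.map ((-(d : ℤ)) • 𝟙 X).hom.hom.hom 1 e) = _
  rw [complexBetti_map_zsmul_id_one_apply, map_smul, Int.cast_neg, Int.cast_natCast]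

/-- `ψ₀^*(pr₂^* e) = pr₁^* e` on `H¹`. [cite: MumfordAV1970, §19] -/
theorem map_offDiag_map_snd_one (hψ₂ : ψ ≫ AbelianVariety.snd X X = AbelianVariety.fst X X)
    (e : complexBetti X.X 1) :
    complexBetti.map ψ.hom.hom.hom 1 (complexBetti.map (AbelianVariety.snd X X).hom.hom.hom 1 e) =
      complexBetti.map (AbelianVariety.fst X X).hom.hom.hom 1 e := by
  change singularCohomology.map ℂ ℂ _ 1 (singularCohomology.map ℂ ℂ _ 1 e) = _
  rw [abelianVarietyHom_map_map_apply, hψ₂]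

/-- **The eigenframe**: for `μ² = -d`, `pr₁^* e + μ · pr₂^* e` is a `μ`-eigenvector of `ψ₀^*` on `H¹(X × X)`.
[cite: vanGeemen1994HodgeAV, proof of Lemma 5.2] -/
theorem map_offDiag_frame
    (hψ₁ : ψ ≫ AbelianVariety.fst X X = AbelianVariety.snd X X ≫ ((-(d : ℤ)) • 𝟙 X))
    (hψ₂ : ψ ≫ AbelianVariety.snd X X = AbelianVariety.fst X X) {μ : ℂ} (hμ : μ ^ 2 = -(d : ℂ))
    (e : complexBetti X.X 1) :
    complexBetti.map ψ.hom.hom.hom 1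
        (complexBetti.map (AbelianVariety.fst X X).hom.hom.hom 1 e +
          μ • complexBetti.map (AbelianVariety.snd X X).hom.hom.hom 1 e) =
      μ • (complexBetti.map (AbelianVariety.fst X X).hom.hom.hom 1 e +
          μ • complexBetti.map (AbelianVariety.snd X X).hom.hom.hom 1 e) := by
  rw [map_add, map_smul, map_offDiag_map_fst_one X d hψ₁, map_offDiag_map_snd_one X hψ₂, smul_add, smul_smul,
    ← sq, hμ, add_comm]

/-- `(pr₁ + t · pr₂)^* e = pr₁^* e + t · pr₂^* e` on `H¹` (additivity of pull-back in the homomorphism).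
[cite: LangeBirkenhake1992, §1.1 (p. 19)] -/
theorem map_fst_add_nsmul_snd_one (t : ℕ) (e : complexBetti X.X 1) :
    complexBetti.map (AbelianVariety.fst X X + t • AbelianVariety.snd X X).hom.hom.hom 1 e =
      complexBetti.map (AbelianVariety.fst X X).hom.hom.hom 1 e +
        ((t : ℕ) : ℂ) • complexBetti.map (AbelianVariety.snd X X).hom.hom.hom 1 e := by
  rw [complexBetti_map_add_one, complexBetti_map_nsmul_one]
  change ((complexBetti.map (AbelianVariety.fst X X).hom.hom.hom 1 +
    t • complexBetti.map (AbelianVariety.snd X X).hom.hom.hom 1).hom) e = _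
  rw [ModuleCat.hom_add, ModuleCat.hom_nsmul, LinearMap.add_apply, LinearMap.smul_apply, Nat.cast_smul_eq_nsmul]

/-- The section `(𝟙, 0)` pulls the frame `pr₁^* e + μ · pr₂^* e` back to `e`. [folklore] -/
theorem map_inl_frame (μ : ℂ) (e : complexBetti X.X 1) :
    complexBetti.map (AbelianVariety.prodLift (𝟙 X) (0 : X ⟶ X)).hom.hom.hom 1
        (complexBetti.map (AbelianVariety.fst X X).hom.hom.hom 1 e +
          μ • complexBetti.map (AbelianVariety.snd X X).hom.hom.hom 1 e) = e := by
  rw [map_add, map_smul, map_inlSection_map_fst_one, map_inlSection_map_snd_one, smul_zero, add_zero]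

end Square

/-! ## §3 The theorem: the Weil plane of a tensor square is algebraic -/
/-- **The Weil plane of a tensor square is algebraic** (registered sub-goal `stub_tensorSquareWeilClassesAlgebraic`,
verbatim): for every complex abelian `n`-fold `X`, `n ≥ 1`, and every `d ≥ 1`,
`weilClassesOf (X × X) ψ₀ n d ≤ algebraicClasses (X × X) n` for the off-diagonal `ψ₀ = ⟨pr₂ ≫ (-d), pr₁⟩`.
See the module docstring for the proof. [cite: vanGeemen1994HodgeAV, 4.9 and proof of Thm. 6.12]
[cite: Markman2025SecantWeil, §1] -/
theorem stub_tensorSquareWeilClassesAlgebraic :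
    ∀ (n d : ℕ), 0 < n → 0 < d → ∀ (X : AbelianVariety ℂ), X.dim = n →
      weilClassesOf (X.prod X)
          (AbelianVariety.prodLift (AbelianVariety.snd X X ≫ ((-(d : ℤ)) • 𝟙 X)) (AbelianVariety.fst X X)) n d ≤
        algebraicClasses (X.prod X).X n := by
  intro n d hn hd X hX
  classical
  -- the off-diagonal endomorphism through its components
  have hψ₀ : AbelianVariety.prodLift (AbelianVariety.snd X X ≫ ((-(d : ℤ)) • 𝟙 X)) (AbelianVariety.fst X X) ≫
      AbelianVariety.prodLift (AbelianVariety.snd X X ≫ ((-(d : ℤ)) • 𝟙 X)) (AbelianVariety.fst X X) =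
        -(d • 𝟙 (X.prod X)) := by
    rw [offDiagonal_comp_self, neg_smul, natCast_zsmul]
  set ψ := AbelianVariety.prodLift (AbelianVariety.snd X X ≫ ((-(d : ℤ)) • 𝟙 X)) (AbelianVariety.fst X X)
  have hψ₁ : ψ ≫ AbelianVariety.fst X X = AbelianVariety.snd X X ≫ ((-(d : ℤ)) • 𝟙 X) :=
    AbelianVariety.prodLift_fst _ _
  have hψ₂ : ψ ≫ AbelianVariety.snd X X = AbelianVariety.fst X X := AbelianVariety.prodLift_snd _ _
  -- dimensions, finiteness, exterior cohomology
  haveI : Module.Finite ℂ (complexBetti X.X 1) := finite_complexBetti_abelianVariety X 1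
  haveI : Module.Finite ℂ (complexBetti (X.prod X).X 1) := finite_complexBetti_abelianVariety (X.prod X) 1
  have hfinX : Module.finrank ℂ (complexBetti X.X 1) = 2 * n := by
    rw [AbelianVariety.finrank_complexBetti_one, hX]
  have hb₁ : Module.finrank ℂ (complexBetti (X.prod X).X 1) = 2 * (2 * n) := by
    rw [AbelianVariety.finrank_complexBetti_one, AbelianVariety.dim_prod, hX]; ring
  have hΛA : HasExteriorCohomologyH1 ℂ (ComplexPoints (X.prod X).X) :=
    abelianVarietyCohomologyExteriorH1_holds.hasExteriorCohomologyH1 (X.prod X)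
  have hAsp : IsSmoothProjective (X.prod X).dim (X.prod X).X := isSmoothProjective_of_dim_eq' rfl
  -- a basis of `H¹(X)`, enumerated along the full index set
  let eX : Module.Basis (Fin (2 * n)) ℂ (complexBetti X.X 1) := Module.finBasisOfFinrankEq ℂ _ hfinX
  let S₀ : Set.powersetCard (Fin (2 * n)) (2 * n) :=
    Set.powersetCard.ofFinEmbEquiv (OrderIso.refl (Fin (2 * n))).toOrderEmbedding
  let σ : Fin (2 * n) ↪o Fin (2 * n) := Set.powersetCard.ofFinEmbEquiv.symm S₀
  let e : Fin (2 * n) → complexBetti X.X 1 := fun k => eX (σ k)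
  let a : Fin (2 * n) → complexBetti (X.prod X).X 1 := fun k =>
    complexBetti.map (AbelianVariety.fst X X).hom.hom.hom 1 (e k)
  let b : Fin (2 * n) → complexBetti (X.prod X).X 1 := fun k =>
    complexBetti.map (AbelianVariety.snd X X).hom.hom.hom 1 (e k)
  let f := cupPowOne ℂ (ComplexPoints (X.prod X).X) (2 * n)
  let w : ℂ → complexBetti (X.prod X).X (2 * n) := fun μ => f (a + μ • b)
  -- (1) `w μ` is a joint eigenclass with character `(x + yμ)²ⁿ` when `μ² = -d`
  have hw_eig : ∀ μ : ℂ, μ ^ 2 = -(d : ℂ) →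
      w μ ∈ pullbackEigenclasses (X.prod X) ψ (2 * n)
        (fun x y => ((x : ℂ) + (y : ℂ) * μ) ^ (2 * n)) := by
    intro μ hμ
    rw [mem_pullbackEigenclasses_iff]
    intro x y
    change singularCohomology.map ℂ ℂ _ (2 * n) (cupPowOne ℂ _ (2 * n) (a + μ • b)) = _
    rw [map_cupPowOne]
    have hv : ∀ i, (a + μ • b) i ∈
        Module.End.eigenspace (complexBetti.map ψ.hom.hom.hom 1).hom μ := by
      intro i
      rw [Module.End.mem_eigenspace_iff]
      exact map_offDiag_frame X d hψ₁ hψ₂ hμ (e i)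
    have heq : (fun i => singularCohomology.map ℂ ℂ
        (Motives.AlgPoints.mapContinuous (L := ℂ) (x • 𝟙 (X.prod X) + y • ψ).hom.hom.hom) 1
          ((a + μ • b) i)) = fun i => ((x : ℂ) + (y : ℂ) * μ) • (a + μ • b) i := by
      funext i
      exact complexBetti_map_nsmul_id_add_nsmul_one_of_mem_eigenspace (hv i) x y
    rw [heq, MultilinearMap.map_smul_univ, Finset.prod_const, Finset.card_univ, Fintype.card_fin]
  -- (2) `w μ ≠ 0`
  have hw_ne : ∀ μ : ℂ, w μ ≠ 0 := by
    intro μ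
    -- the frame indexed by the basis itself is linearly independent (pull back along `(𝟙, 0)`)
    let v₀ : Fin (2 * n) → complexBetti (X.prod X).X 1 := fun k =>
      complexBetti.map (AbelianVariety.fst X X).hom.hom.hom 1 (eX k) +
        μ • complexBetti.map (AbelianVariety.snd X X).hom.hom.hom 1 (eX k)
    have hv₀ : LinearIndependent ℂ v₀ := by
      refine LinearIndependent.of_comp
        (complexBetti.map (AbelianVariety.prodLift (𝟙 X) (0 : X ⟶ X)).hom.hom.hom 1).hom ?_
      have hcomp : ((complexBetti.map (AbelianVariety.prodLift (𝟙 X) (0 : X ⟶ X)).hom.hom.hom 1).hom ∘ v₀) =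
          eX := funext fun k => map_inl_frame X μ (eX k)
      rw [hcomp]
      exact eX.linearIndependent
    have hind := exteriorPower.ιMulti_family_linearIndependent_field (n := 2 * n) hv₀
    have hne : exteriorPower.ιMulti_family ℂ (2 * n) v₀ S₀ ≠ 0 := hind.ne_zero S₀
    intro hw
    apply hne
    apply hΛA.eq_zero_of_wedgeToCup_eq_zero
    change wedgeToCup ℂ _ (2 * n) (exteriorPower.ιMulti ℂ (2 * n) (v₀ ∘ σ)) = 0
    rw [wedgeToCup_ιMulti]
    exact hw
  -- (3) `w μ` is algebraic, for every `μ`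
  have hw_alg : ∀ μ : ℂ, w μ ∈ algebraicClasses (X.prod X).X n := by
    intro μ
    -- the top wedge of `X` is non-zero …
    have hΩ : cupPowOne ℂ (ComplexPoints X.X) (2 * n) e ≠ 0 := by
      have hind := exteriorPower.ιMulti_family_linearIndependent_field (n := 2 * n) eX.linearIndependent
      have hne : exteriorPower.ιMulti_family ℂ (2 * n) eX S₀ ≠ 0 := hind.ne_zero S₀
      intro hΩ
      apply hne
      apply (abelianVarietyCohomologyExteriorH1_holds.hasExteriorCohomologyH1 X).eq_zero_of_wedgeToCup_eq_zero
      change wedgeToCup ℂ _ (2 * n) (exteriorPower.ιMulti ℂ (2 * n) (eX ∘ σ)) = 0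
      rw [wedgeToCup_ιMulti]
      exact hΩ
    -- … and a multiple of a non-zero ALGEBRAIC top class `Z` (the top cohomology of `X` is a line)
    obtain ⟨Z, hZ0, hZalg⟩ := exists_ne_zero_mem_algebraicClasses_top X hX hn e hΩ
    have htop : Module.finrank ℂ (complexBetti X.X (2 * n)) = 1 := by
      have h := abelianVarietyCohomologyExteriorH1_holds.finrank_top X
      rwa [hX] at h
    haveI : Module.Finite ℂ (complexBetti X.X (2 * n)) := finite_complexBetti_abelianVariety X (2 * n)
    obtain ⟨c, hc⟩ := (finrank_eq_one_iff_of_nonzero' Z hZ0).1 htop (cupPowOne ℂ (ComplexPoints X.X) (2 * n) e)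
    -- the values at `t ∈ ℕ` are pull-backs of `c • Z` along the homomorphisms `pr₁ + t·pr₂`
    have hnat : ∀ t : ℕ, f (a + ((t : ℕ) : ℂ) • b) =
        c • complexBetti.map (AbelianVariety.fst X X + t • AbelianVariety.snd X X).hom.hom.hom (2 * n) Z := by
      intro t
      rw [← map_smul, hc]
      change _ = singularCohomology.map ℂ ℂ _ (2 * n) (cupPowOne ℂ _ (2 * n) e)
      rw [map_cupPowOne]
      congr 1
      funext i
      exact (map_fst_add_nsmul_snd_one X t (e i)).symm
    have halg_nat : ∀ t : ℕ, f (a + ((t : ℕ) : ℂ) • b) ∈ algebraicClasses (X.prod X).X n := by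
      intro t
      rw [hnat]
      exact Submodule.smul_mem _ c (map_mem_algebraicClasses_of_abelianVariety hAsp X _ hZalg)
    -- interpolation
    refine (Submodule.span_le.2 ?_) (apply_add_smul_mem_span f a b μ)
    rintro _ ⟨t, rfl⟩
    exact halg_nat t
  -- (4) assembly: both Weil lines are spanned by the algebraic classes `w(±i√d)`
  have hsq : (Complex.I * (Real.sqrt d : ℂ)) ^ 2 = -(d : ℂ) := I_mul_sqrt_sq d
  have hP : weilClassesPlus (X.prod X) ψ n d ≤ algebraicClasses (X.prod X).X n := by
    have h₁ : w (Complex.I * (Real.sqrt d : ℂ)) ∈ weilClassesPlus (X.prod X) ψ n d := by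
      have e' : (fun x y : ℕ => ((x : ℂ) + (y : ℂ) * Complex.I * (Real.sqrt d : ℂ)) ^ (2 * n)) =
          fun x y : ℕ => ((x : ℂ) + (y : ℂ) * (Complex.I * (Real.sqrt d : ℂ))) ^ (2 * n) := by
        funext x y; rw [mul_assoc]
      rw [weilClassesPlus, e']
      exact hw_eig _ hsq
    refine (weilClassesPlus_le_span_singleton hΛA hb₁ hd hψ₀ h₁ (hw_ne _)).trans ?_
    rw [Submodule.span_le, Set.singleton_subset_iff]
    exact hw_alg _
  have hM : weilClassesMinus (X.prod X) ψ n d ≤ algebraicClasses (X.prod X).X n := by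
    have h₂ : w (-(Complex.I * (Real.sqrt d : ℂ))) ∈ weilClassesMinus (X.prod X) ψ n d := by
      have e' : (fun x y : ℕ => ((x : ℂ) - (y : ℂ) * Complex.I * (Real.sqrt d : ℂ)) ^ (2 * n)) =
          fun x y : ℕ => ((x : ℂ) + (y : ℂ) * (-(Complex.I * (Real.sqrt d : ℂ)))) ^ (2 * n) := by
        funext x y; rw [mul_neg, ← sub_eq_add_neg, mul_assoc]
      rw [weilClassesMinus, e']
      exact hw_eig _ (by rw [neg_sq, hsq])
    refine (weilClassesMinus_le_span_singleton hΛA hb₁ hd hψ₀ h₂ (hw_ne _)).trans ?_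
    rw [Submodule.span_le, Set.singleton_subset_iff]
    exact hw_alg _
  exact sup_le hP hM

/-! ## §4 The crux on every tensor tenfold -/
/-- **`WeilTenfoldsSqrtMinus11` on every tensor tenfold** (registered sub-goal `stub_tensorSquareCrux`, verbatim):
for every complex abelian fivefold `X`, with `A = X × X` and `ψ₀ = ⟨pr₂ ≫ (-11), pr₁⟩` (`ψ₀ ≫ ψ₀ = -11`), every
rational `(5,5)`-class of `H¹⁰(A(ℂ); ℂ)` in `Eig((𝟙 + ψ₀)^*, (1 + i√11)¹⁰) ⊔ Eig((𝟙 + ψ₀)^*, (1 - i√11)¹⁰)` lies in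
`algebraicClasses A 5` — the crux's hypotheses-to-conclusion at `(A, ψ₀)`. Proof: the typed plane lies in the strong
Weil plane (`stub_upgrade`, landed), which is algebraic by `stub_tensorSquareWeilClassesAlgebraic` at
`(n, d) = (5, 11)`; rationality and Hodge type are not even needed. [cite: vanGeemen1994HodgeAV, 4.9 and Thm. 6.12] -/
theorem stub_tensorSquareCrux :
    ∀ (X : AbelianVariety ℂ), X.dim = 5 →
      ∀ c : complexBetti (X.prod X).X 10, IsRationalClass c → IsOfHodgeType 10 (X.prod X).X 10 5 5 c →
        c ∈ Module.End.eigenspace (complexBetti.map (𝟙 (X.prod X) +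
                AbelianVariety.prodLift (AbelianVariety.snd X X ≫ ((-(11 : ℤ)) • 𝟙 X))
                  (AbelianVariety.fst X X)).hom.hom.hom 10).hom
              ((1 + Complex.I * (Real.sqrt (11 : ℝ) : ℂ)) ^ 10) ⊔
            Module.End.eigenspace (complexBetti.map (𝟙 (X.prod X) +
                AbelianVariety.prodLift (AbelianVariety.snd X X ≫ ((-(11 : ℤ)) • 𝟙 X))
                  (AbelianVariety.fst X X)).hom.hom.hom 10).hom
              ((1 - Complex.I * (Real.sqrt (11 : ℝ) : ℂ)) ^ 10) →
        c ∈ algebraicClasses (X.prod X).X 5 := by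
  intro X hX c _ _ hW
  have hφ : AbelianVariety.prodLift (AbelianVariety.snd X X ≫ ((-(11 : ℤ)) • 𝟙 X)) (AbelianVariety.fst X X) ≫
      AbelianVariety.prodLift (AbelianVariety.snd X X ≫ ((-(11 : ℤ)) • 𝟙 X)) (AbelianVariety.fst X X) =
        -(((11 : ℕ) : ℤ) • 𝟙 (X.prod X)) := by
    rw [offDiagonal_comp_self, neg_smul]; rfl
  set ψ := AbelianVariety.prodLift (AbelianVariety.snd X X ≫ ((-(11 : ℤ)) • 𝟙 X)) (AbelianVariety.fst X X)
  have hA : (X.prod X).dim = 2 * 5 := by rw [AbelianVariety.dim_prod, hX]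
  have hcW : c ∈ weilClassesOf (X.prod X) ψ 5 11 := by
    refine Summit.HodgeConjecture.HodgeConjecture.Theorems.HeckePrymWeilLine.stub_upgrade 11 (by norm_num)
      (by norm_num) (by norm_num) 5 (X.prod X) ψ hA hφ ?_
    exact_mod_cast hW
  have h := stub_tensorSquareWeilClassesAlgebraic 5 11 (by norm_num) (by norm_num) X hX
  exact h (by exact_mod_cast hcW)

end Summit.HodgeConjecture.HodgeConjecture.Theorems.WeilTenfoldsSqrtMinus11.TensorSquare

end
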